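import Summits.ResolutionOfSingularities.ResolutionOfSingularities.Theorems.UniversalCellsCampaignW82TwistFiniteModel
import Summits.ResolutionOfSingularities.ResolutionOfSingularities.Theorems.UniformComplexityCampaignW82TwistNormalRung
import Mathlib.FieldTheory.KummerPolynomial
import Mathlib.FieldTheory.IsAlgClosed.AlgebraicClosure
import HarnessLib

/-!
# [OURS · L1 W8.2] The finite-modification («normalise the twist») steps BY NAME: refuted from dimension 2

Cell `res-hironaka` (run/shared/lean/pub/res-hironaka/), LADDER-RESOLUTION rung L (RESCUE), slot W8.2 of
plan/RESCUE-SEED.md, door 2 = route `UniformComplexity`, host item `PrimeModelTransfer`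
(stmt-ResolutionOfSingularities-8933); prover res-L1-s82-pv-2 (gen 4). THESES-FREE LINKS module: imports the OURS
statement file Theorems/UniversalCellsCampaignW82TwistFiniteModel.lean (typer res-L1-type-o6:
`CampaignW82.HasSmoothFiniteTwistModel p K f₀`, `FrobeniusTwistStepFiniteAt / …FiniteRegularAt p M n`) and the gen-4
proof files Theorems/UniformComplexityCampaignW82TwistNormal{,Regular,Rung}.lean (res-L1-s82-pv-2), and records the
verdicts BY NAME; short proofs, no new mathematics.

[OURS · L1 W8.2] replaces the role of no printed item; NOT statements of H. Hironaka's manuscript. For every prime `p`: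

* `TwistNormal.not_hasSmoothFiniteTwistModel_surf K t`: for EVERY field `K` of characteristic `p` and every
  `t ∈ K`, the surface `Y_t : x^p − t = yz` has NO finite birational modification of ANY Frobenius twist smooth
  over `K` (levels `≥ 1`: the twist is the normal non-regular `A_{p−1}` surface; level `0`: `Y_t` is regular for
  `t ∉ K^p` and the `A_{p−1}` surface for `t ∈ K^p`). A smooth-over-`K` source of a birational map onto an integral
  scheme is integral (reduced: Stacks 056S; irreducible: tree `IsBirational.isIntegral`), so no integrality
  hypothesis on the source is needed.
* Hence, for every field `M` of characteristic `p` and every grade `n ≥ 2`: the conclusion blocks of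
  `FrobeniusTwistStepFiniteRegularAt p M n` and `FrobeniusTwistStepFiniteAt p M n` FAIL
  (`not_frobeniusTwistStepFiniteRegularAt_conclusion`; witness `Y_t`, `t = RatFunc.X`, regular); the steps hold iff
  their hypothesis block fails (`frobeniusTwistStepFiniteRegularAt_iff_not_hyp`, `frobeniusTwistStepFiniteAt_iff_not_hyp`);
  they are FALSE for `2 ≤ n ≤ 3` given FACT-LIST F-02 (`not_frobeniusTwistStepFiniteRegularAt_of_le_three`,
  `not_frobeniusTwistStepFiniteAt_of_le_three`), and at `⊤` equivalent to «no resolution over `M(t)`»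
  (`frobeniusTwistStepFiniteRegularAt_top_iff`), refuted by `ResolutionInChar p`; door-2 shape
  `not_forall_isAlgClosed_frobeniusTwistStepFiniteRegularAt_conclusion_two`. Grade `n = 1` (where «normalise the
  twist» is expected to WORK) is not decided here.

HONEST FRAMING. OURS bookkeeping; AI work, weaker than expert review; nothing is attributed to H. Hironaka. No
`sorry`, no new axioms.
-/

noncomputable section

set_option linter.dupNamespace false -- mandated namespace of this single-conjunct summit

open Polynomial
open _root_.CategoryTheory _root_.CategoryTheory.Limits _root_.AlgebraicGeometry
open Literature.AlgebraicGeometry.Resolution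

namespace Summit.ResolutionOfSingularities.ResolutionOfSingularities.Theorems.CampaignW82

namespace TwistNormal

variable (K : Type) [Field K] (p : ℕ) [hp : Fact p.Prime] [CharP K p] (t : K)

/-- **`Y_t` has NO finite birational modification of any Frobenius twist smooth over `K`** (every field `K` of
characteristic `p`, every `t`). [folklore] -/
theorem not_hasSmoothFiniteTwistModel_surf : ¬ HasSmoothFiniteTwistModel p K (surfTo K p t) := by
  rintro ⟨e, Y, π, hF, hB, hS⟩
  haveI := hF
  haveI : IsReduced Y := isReduced_of_smooth (π ≫ pullback.snd (surfTo K p t)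
    (Spec.map (CommRingCat.ofHom (iterateFrobenius K p e))))
  cases e with
  | succ k =>
    haveI := isIntegral_twist K p t k
    haveI : IsIntegral Y := hB.isIntegral
    exact no_smooth_finite_model_twist K p t k Y π hB hS
  | zero =>
    by_cases ht : ∃ τ : K, τ ^ p = t
    · obtain ⟨τ, hτ⟩ := ht
      have hτ' : τ ^ p = iterateFrobenius K p 0 t := by rw [iterateFrobenius_zero_apply]; exact hτ
      haveI := isIntegral_baseChange K p t (iterateFrobenius K p 0) τ hτ'
      haveI : IsIntegral Y := hB.isIntegral
      exact no_smooth_finite_model_baseChange K p t (iterateFrobenius K p 0) τ hτ' Y π hB hS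
    · have hirr : Irreducible (X ^ p - C t : K[X]) :=
        X_pow_sub_C_irreducible_of_prime hp.out fun b hb => ht ⟨b, hb⟩
      haveI := isIntegral_surf K p (iterateFrobenius K p 0 t)
      haveI : IsIntegral (pullback (surfTo K p t) (Spec.map (CommRingCat.ofHom (iterateFrobenius K p 0)))) :=
        IsIntegral.of_isIso (baseChangeIso K p t (iterateFrobenius K p 0)).inv
      haveI : IsIntegral Y := hB.isIntegral
      exact no_smooth_finite_model_twist_zero K p t hirr Y π hB hS

end TwistNormal

variable (p : ℕ) [hp : Fact p.Prime] (M : Type) [Field M] [CharP M p]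

/-- **The conclusion block of the finite REGULAR step fails over `M(t)` in every grade `n ≥ 2`** (witness: the regular
surface `Y_t`, `t = RatFunc.X`). [folklore] -/
theorem not_frobeniusTwistStepFiniteRegularAt_conclusion {n : WithBot ℕ∞} (hn : 2 ≤ n) :
    ¬ ∀ (X₀ : Scheme.{0}) (f₀ : X₀ ⟶ Spec (.of (RatFunc M))),
      IsSeparated f₀ → LocallyOfFiniteType f₀ → QuasiCompact f₀ → topologicalKrullDim X₀ ≤ n →
        IntegralOverPerfectClosure (RatFunc M) f₀ → Scheme.IsRegular X₀ →
          HasSmoothFiniteTwistModel p (RatFunc M) f₀ := by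
  intro h
  have ht : Irreducible (X ^ p - C (RatFunc.X : RatFunc M)) := TwistExponent.irreducible_X_pow_sub_C_ratFuncX p M
  have hd : topologicalKrullDim ↥(TwistNormal.surf (RatFunc M) p RatFunc.X) ≤ n :=
    (TwistNormal.topologicalKrullDim_surf_le_two (RatFunc M) p RatFunc.X hp.out.ne_zero).trans (by exact_mod_cast hn)
  exact TwistNormal.not_hasSmoothFiniteTwistModel_surf (RatFunc M) p RatFunc.X
    (h _ _ inferInstance (TwistNormal.locallyOfFiniteType_surfTo (RatFunc M) p RatFunc.X) inferInstance hd
      (TwistNormal.integralOverPerfectClosure_surf (RatFunc M) p RatFunc.X)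
      (TwistNormal.isRegular_surf (RatFunc M) p RatFunc.X ht))

/-- **The finite REGULAR step holds iff its hypothesis block fails** (`n ≥ 2`, every `M` of characteristic `p`).
[folklore] -/
theorem frobeniusTwistStepFiniteRegularAt_iff_not_hyp {n : WithBot ℕ∞} (hn : 2 ≤ n) :
    FrobeniusTwistStepFiniteRegularAt p M n ↔
      ¬ ∀ (X : Scheme.{0}) (f : X ⟶ Spec (.of (RatFunc M))),
        IsSeparated f → LocallyOfFiniteType f → QuasiCompact f → IsIntegral X →
          topologicalKrullDim X ≤ n → Scheme.HasResolution X :=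
  ⟨fun h hyp => not_frobeniusTwistStepFiniteRegularAt_conclusion p M hn (h hyp), fun h hyp => absurd hyp h⟩

/-- **The finite step holds iff its hypothesis block fails** (`n ≥ 2`). [folklore] -/
theorem frobeniusTwistStepFiniteAt_iff_not_hyp {n : WithBot ℕ∞} (hn : 2 ≤ n) :
    FrobeniusTwistStepFiniteAt p M n ↔
      ¬ ∀ (X : Scheme.{0}) (f : X ⟶ Spec (.of (RatFunc M))),
        IsSeparated f → LocallyOfFiniteType f → QuasiCompact f → IsIntegral X →
          topologicalKrullDim X ≤ n → Scheme.HasResolution X :=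
  ⟨fun h => (frobeniusTwistStepFiniteRegularAt_iff_not_hyp p M hn).mp
      (frobeniusTwistStepFiniteRegularAt_of_frobeniusTwistStepFiniteAt h),
    fun h hyp => absurd hyp h⟩

/-- **`2 ≤ n ≤ 3`: the finite regular step is FALSE, CONDITIONAL on FACT-LIST F-02** (`hCP : CossartPiltant2019`):
«normalise some twist» does not prove the residual for surfaces or threefolds. [cite: CossartPiltant2019, Thm. 1.1] -/
theorem not_frobeniusTwistStepFiniteRegularAt_of_le_three (hCP : CossartPiltant2019.{0}) {n : WithBot ℕ∞}
    (h2 : 2 ≤ n) (h3 : n ≤ 3) : ¬ FrobeniusTwistStepFiniteRegularAt p M n :=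
  fun h => (frobeniusTwistStepFiniteRegularAt_iff_not_hyp p M h2).mp h fun X f hs hl hq _ hd =>
    hCP (RatFunc M) X f hs hl hq inferInstance (hd.trans h3)

/-- **`2 ≤ n ≤ 3`: the finite step is FALSE, CONDITIONAL on F-02.** [cite: CossartPiltant2019, Thm. 1.1] -/
theorem not_frobeniusTwistStepFiniteAt_of_le_three (hCP : CossartPiltant2019.{0}) {n : WithBot ℕ∞}
    (h2 : 2 ≤ n) (h3 : n ≤ 3) : ¬ FrobeniusTwistStepFiniteAt p M n :=
  fun h => not_frobeniusTwistStepFiniteRegularAt_of_le_three p M hCP h2 h3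
    (frobeniusTwistStepFiniteRegularAt_of_frobeniusTwistStepFiniteAt h)

/-- **At `n = ⊤` the finite regular step is «no resolution over `M(t)`»** — refuted by `ResolutionInChar p`.
[folklore] -/
theorem frobeniusTwistStepFiniteRegularAt_top_iff :
    FrobeniusTwistStepFiniteRegularAt p M ⊤ ↔
      ¬ ∀ (X : Scheme.{0}) (f : X ⟶ Spec (.of (RatFunc M))),
        IsSeparated f → LocallyOfFiniteType f → QuasiCompact f → IsIntegral X → Scheme.HasResolution X := by
  rw [frobeniusTwistStepFiniteRegularAt_iff_not_hyp p M (by exact_mod_cast le_top)]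
  exact not_congr ⟨fun h X f hs hl hq hi => h X f hs hl hq hi le_top, fun h X f hs hl hq hi _ => h X f hs hl hq hi⟩

/-- `ResolutionInChar p` refutes the finite regular step at `⊤` (every `M`). [folklore] -/
theorem not_frobeniusTwistStepFiniteRegularAt_top_of_resolutionInChar (h : ResolutionInChar.{0} p) :
    ¬ FrobeniusTwistStepFiniteRegularAt p M ⊤ :=
  fun hs => (frobeniusTwistStepFiniteRegularAt_top_iff p M).mp hs fun X f hs' hl hq _ =>
    h (RatFunc M) X f hs' hl hq inferInstance

/-- **Door 2's shape**: the conclusion block of the finite regular step at grade `2` fails for every algebraically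
closed `M` of characteristic `p` (indeed for every `M`). [folklore] -/
theorem not_forall_isAlgClosed_frobeniusTwistStepFiniteRegularAt_conclusion_two :
    ¬ ∀ (M : Type) [Field M] [CharP M p] [IsAlgClosed M],
      ∀ (X₀ : Scheme.{0}) (f₀ : X₀ ⟶ Spec (.of (RatFunc M))),
        IsSeparated f₀ → LocallyOfFiniteType f₀ → QuasiCompact f₀ → topologicalKrullDim X₀ ≤ 2 →
          IntegralOverPerfectClosure (RatFunc M) f₀ → Scheme.IsRegular X₀ →
            HasSmoothFiniteTwistModel p (RatFunc M) f₀ := fun h =>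
  not_frobeniusTwistStepFiniteRegularAt_conclusion p (AlgebraicClosure (ZMod p)) le_rfl
    (h (AlgebraicClosure (ZMod p)))

end Summit.ResolutionOfSingularities.ResolutionOfSingularities.Theorems.CampaignW82

end
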